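import Summits.NavierStokesRegularity.OSWSelfSimilar.SheetRCutoffApproximation
import HarnessLib

/-!
# SHEET-ℝ frame: the cutoff inequality and UNIQUENESS for the linearised operator WITH A BOUNDED PERTURBATION `K : E → L²_w`
# (scalar and skew-coupled pair) — the analytic core of (P1) for cert-1's full operator `A_F = B_λ − P + F`

HONEST FRAMING (cell ns-blowup GROUP B / zone Z3, case Z3-SR-SPEC, PAPER item (P1) for `A_F = DG(Ω̄) + F`, SHEET-R-SPEC-PRICE-impl1 (S1)/(S3);
1-D MODEL certificate frame (viscous gCLM/OSW sheet on the line); not Euler/NS; «violates: none — MODEL»). Nothing here asserts that a profile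
exists; `K` is an ARBITRARY bounded real operator `Esp L hL →L[ℝ] W L` and the coercivity of the perturbed form ON TESTS is the HYPOTHESIS
(for cert-1 it is the interval datum (S1) «`q_γ ≥ c₁W + c₂K′` on E»).

The perturbed weak form of `A = (−∂² + d∂ + V) + K` is `a(p; φ) = linForm(u; φ) + ∫ w (Kp) φ` (`u = prim (der p)`).  Testing with `χ_R²u` and
applying the test coercivity to `χ_R u` produces, besides the local correction `C·tail` of `SheetRLinearisedCutoffEnergy.linForm_cutoff_le`,
the COMMUTATOR `∫ w (K(χ_R u) − χ_R Kp)(χ_R u)`, which tends to zero because `χ_R u → u` in the ENERGY norm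
(`SheetRCutoffApproximation.sq_norm_jmap_cutoff_sub_le`) and `K` is bounded:

* `cutoff_ineq_K` — `κ/4·∫_{ξ²<R²} w u² ≤ a(p; χ_R²u) + C·tail_u(R) + err(R)`, with the EXPLICIT
  `err(R) = (‖K‖·((¼ + 2M²)tail_u + 2 tail_{u₁})^{1/2} + tail_{Kp}^{1/2})·‖u‖_w`, and `tendsto_err` (`err(n+1) → 0`);
* `eq_zero_of_weakK` — **uniqueness**: `a(p; φ) = 0` for all compactly supported tests ⇒ `p = 0`;
* `pair_eq_zero_of_weakK` — **pair uniqueness**: `a(p_R; φ) − t∫w u_I φ = 0`, `a(p_I; φ) + t∫w u_R φ = 0` for all tests ⇒ `p_R = p_I = 0`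
  (the realified homogeneous equation `(A + it)(u_R + iu_I) = 0`; the skew terms cancel on adding).

Pure functional analysis; no definition, no named fact.  WHAT THIS IS NOT: not NS; no number of record moves.
-/

noncomputable section

namespace Summit.NavierStokesRegularity.OSWSelfSimilar
namespace SheetRPerturbedUniqueness

open _root_.MeasureTheory _root_.Set _root_.Filter _root_.Real SheetRWeakProfilePV SheetRWeakToStrong SheetREnergyClass SheetRWeightedMeasure
  SheetRLinearisedTests SheetREnergySpace SheetRTestSpace SheetRLinearisedFormBounds SheetRSolutionOperator SheetRLinearisedCutoffEstimates
  SheetRLinearisedCutoffEnergy SheetRLinearisedUniqueness SheetRResolventPair SheetRComplexPivot SheetRCutoffApproximation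
open scoped Topology ENNReal

variable {L D₀ D₁ V₀ : ℝ} {d V : ℝ → ℝ}

/-! ### §1 The perturbed cutoff inequality -/

/-- **The cutoff inequality with a bounded perturbation `K`.**  Under `κ`-coercivity of the perturbed form on tests, for `p ∈ Esp` with profile
`u = prim (der p)`, `u₁ = der p`, `R ≥ 1`, `|χ_R′| ≤ M/R`:
`κ/4·∫_{ξ²<R²} w u² ≤ [linForm(u; χ_R²u) + ∫ w (Kp)·χ_R²u] + C·∫_{R²≤ξ²} w u² + err(R)`,
`err(R) = (‖K‖·((¼ + 2M²)∫_{R²≤ξ²} w u² + 2∫_{R²≤ξ²} w u₁²)^{1/2} + (∫_{R²≤ξ²} w (Kp)²)^{1/2})·(∫ w u²)^{1/2}`. [folklore] -/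
theorem cutoff_ineq_K (hL : 0 < L) (hdm : AEStronglyMeasurable d volume) (hVm : AEStronglyMeasurable V volume)
    (hD₀ : 0 ≤ D₀) (hD₁ : 0 ≤ D₁) (hd : ∀ ξ, |d ξ| ≤ D₀ + D₁ * |ξ|) (hV : ∀ ξ, |V ξ| ≤ V₀)
    (K : Esp L hL →L[ℝ] W L) {κ : ℝ} (hκ : 0 < κ)
    (hcoerK : ∀ vp : testSpace, κ * ‖jmap hL vp‖ ^ 2 ≤
      linForm L d V vp.1.1 vp.1.2 vp.1.1 vp.1.2 + ∫ y, (L ^ 2 + y ^ 2) * (((K (jmap hL vp) : W L) : ℝ → ℝ) y * vp.1.1 y))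
    (p : Esp L hL) {M : ℝ} (hM0 : 0 ≤ M) {R : ℝ} (hR : 1 ≤ R) (hM : ∀ ξ : ℝ, |deriv (cutoff R) ξ| ≤ M / R) :
    κ / 4 * ∫ ξ in {ξ : ℝ | R ^ 2 ≤ ξ ^ 2}ᶜ, (L ^ 2 + ξ ^ 2) * prim (der p) ξ ^ 2 ≤
      (linForm L d V (prim (der p)) (der p) (fun ξ => cutoff R ξ * (cutoff R ξ * prim (der p) ξ))
          (fun ξ => deriv (cutoff R) ξ * (cutoff R ξ * prim (der p) ξ) + cutoff R ξ * (deriv (cutoff R) ξ * prim (der p) ξ + cutoff R ξ * der p ξ))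
        + ∫ y, (L ^ 2 + y ^ 2) * (((K p : W L) : ℝ → ℝ) y * (cutoff R y * (cutoff R y * prim (der p) y))))
      + (M ^ 2 + 4 * M / L ^ 2 + M * (D₀ + 2 * D₁)) * (∫ ξ in {ξ : ℝ | R ^ 2 ≤ ξ ^ 2}, (L ^ 2 + ξ ^ 2) * prim (der p) ξ ^ 2)
      + (‖K‖ * Real.sqrt ((1 / 4 + 2 * M ^ 2) * (∫ y in {ξ : ℝ | R ^ 2 ≤ ξ ^ 2}, (L ^ 2 + y ^ 2) * prim (der p) y ^ 2)
            + 2 * ∫ y in {ξ : ℝ | R ^ 2 ≤ ξ ^ 2}, (L ^ 2 + y ^ 2) * der p y ^ 2)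
          + Real.sqrt (∫ y in {ξ : ℝ | R ^ 2 ≤ ξ ^ 2}, (L ^ 2 + y ^ 2) * ((K p : W L) : ℝ → ℝ) y ^ 2))
        * Real.sqrt (∫ y, (L ^ 2 + y ^ 2) * prim (der p) y ^ 2) := by
  have hR0 : 0 < R := by linarith
  obtain ⟨hu', hodd', hu₁m', h0', h1', -, -⟩ := energyClass_of_mem hL p
  have hu : ∀ x, prim (der p) x = prim (der p) 0 + ∫ s in (0 : ℝ)..x, der p s := hu'
  have hodd : ∀ y, prim (der p) (-y) = -prim (der p) y := hodd'
  have hu₁m : AEStronglyMeasurable (der p) volume := hu₁m'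
  have h0 : Integrable fun y => (L ^ 2 + y ^ 2) * prim (der p) y ^ 2 := h0'
  have h1 : Integrable fun y => (L ^ 2 + y ^ 2) * der p y ^ 2 := h1'
  obtain ⟨huc, hu₁2, hu2, -, -⟩ := basic_of_primitive hL hu hu₁m h0 h1
  -- the cutoff test `τ` and the double cutoff test
  obtain ⟨hτ, -⟩ := isCompactTest_cutoff_mul hR0 hu hodd hu₁2 hu2
  have hτ2 := isCompactTest_cutoff_sq_mul hR0 hu hodd hu₁2 hu2
  set τ : testSpace := ⟨(fun ξ => cutoff R ξ * prim (der p) ξ, fun ξ => deriv (cutoff R) ξ * prim (der p) ξ + cutoff R ξ * der p ξ), hτ⟩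
    with hτdef
  -- (1) coercivity on `τ`
  have hco := hcoerK τ
  -- (2) the local cutoff inequality
  have hcut := linForm_cutoff_le hL hdm hVm hD₀ hD₁ hd hV hu hu₁m h0 h1 hM0 hR hM
  -- (3) the `K`-terms: `∫ w K(jmap τ)·χu = ∫ w (Kp)·χ²u + commutator`
  obtain ⟨hcomm_int, hcomm_le⟩ := abs_commutator_le hL hR0 (K p) (K (jmap hL τ)) huc h0
  have hKp_int := integrable_weight_mul_test hL (K p) hτ2
  have hsplit : ∫ y, (L ^ 2 + y ^ 2) * (((K (jmap hL τ) : W L) : ℝ → ℝ) y * (τ : (ℝ → ℝ) × (ℝ → ℝ)).1 y) =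
      (∫ y, (L ^ 2 + y ^ 2) * (((K p : W L) : ℝ → ℝ) y * (cutoff R y * (cutoff R y * prim (der p) y))))
        + ∫ y, (L ^ 2 + y ^ 2) * ((((K (jmap hL τ) : W L) : ℝ → ℝ) y - cutoff R y * ((K p : W L) : ℝ → ℝ) y)
            * (cutoff R y * prim (der p) y)) := by
    rw [← integral_add hKp_int hcomm_int]
    refine integral_congr_ae (Eventually.of_forall fun y => ?_)
    show (L ^ 2 + y ^ 2) * (((K (jmap hL τ) : W L) : ℝ → ℝ) y * (cutoff R y * prim (der p) y)) = _
    ring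
  -- (4) the commutator size: `‖K(jmap τ) − Kp‖ ≤ ‖K‖·‖jmap τ − p‖ ≤ ‖K‖·√(...)`
  have hKdiff : ‖K (jmap hL τ) - K p‖ ≤ ‖K‖ * Real.sqrt ((1 / 4 + 2 * M ^ 2) * (∫ y in {ξ : ℝ | R ^ 2 ≤ ξ ^ 2}, (L ^ 2 + y ^ 2) * prim (der p) y ^ 2)
      + 2 * ∫ y in {ξ : ℝ | R ^ 2 ≤ ξ ^ 2}, (L ^ 2 + y ^ 2) * der p y ^ 2) := by
    rw [← map_sub]
    refine (K.le_opNorm _).trans (mul_le_mul_of_nonneg_left ?_ (norm_nonneg K))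
    have hsq := sq_norm_jmap_cutoff_sub_le hL p hR hM0 hM hτ
    calc ‖jmap hL τ - p‖ = Real.sqrt (‖jmap hL τ - p‖ ^ 2) := (Real.sqrt_sq (norm_nonneg _)).symm
      _ ≤ _ := Real.sqrt_le_sqrt hsq
  -- (5) lower bound from the `jmap` norm and the plateau
  have hjn := sq_norm_jmap hL τ
  have hplat := (plateau_mass_le (L := L) hR0 huc h0).2
  have hv₁nn : 0 ≤ ∫ y, (L ^ 2 + y ^ 2) * (τ : (ℝ → ℝ) × (ℝ → ℝ)).2 y ^ 2 := integral_nonneg fun y => by positivity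
  have hτ1 : (τ : (ℝ → ℝ) × (ℝ → ℝ)).1 = fun ξ => cutoff R ξ * prim (der p) ξ := rfl
  rw [hτ1] at hjn
  -- assemble
  have hcomm_le' : |∫ y, (L ^ 2 + y ^ 2) * ((((K (jmap hL τ) : W L) : ℝ → ℝ) y - cutoff R y * ((K p : W L) : ℝ → ℝ) y)
      * (cutoff R y * prim (der p) y))| ≤
      (‖K‖ * Real.sqrt ((1 / 4 + 2 * M ^ 2) * (∫ y in {ξ : ℝ | R ^ 2 ≤ ξ ^ 2}, (L ^ 2 + y ^ 2) * prim (der p) y ^ 2)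
            + 2 * ∫ y in {ξ : ℝ | R ^ 2 ≤ ξ ^ 2}, (L ^ 2 + y ^ 2) * der p y ^ 2)
          + Real.sqrt (∫ y in {ξ : ℝ | R ^ 2 ≤ ξ ^ 2}, (L ^ 2 + y ^ 2) * ((K p : W L) : ℝ → ℝ) y ^ 2))
        * Real.sqrt (∫ y, (L ^ 2 + y ^ 2) * prim (der p) y ^ 2) := by
    refine hcomm_le.trans (mul_le_mul_of_nonneg_right (add_le_add hKdiff le_rfl) (Real.sqrt_nonneg _))
  have hab := le_abs_self (∫ y, (L ^ 2 + y ^ 2) * ((((K (jmap hL τ) : W L) : ℝ → ℝ) y - cutoff R y * ((K p : W L) : ℝ → ℝ) y)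
      * (cutoff R y * prim (der p) y)))
  rw [hsplit] at hco
  have hE : linForm L d V (τ : (ℝ → ℝ) × (ℝ → ℝ)).1 (τ : (ℝ → ℝ) × (ℝ → ℝ)).2 (τ : (ℝ → ℝ) × (ℝ → ℝ)).1 (τ : (ℝ → ℝ) × (ℝ → ℝ)).2 =
      linForm L d V (fun ξ => cutoff R ξ * prim (der p) ξ) (fun ξ => deriv (cutoff R) ξ * prim (der p) ξ + cutoff R ξ * der p ξ)
        (fun ξ => cutoff R ξ * prim (der p) ξ) (fun ξ => deriv (cutoff R) ξ * prim (der p) ξ + cutoff R ξ * der p ξ) := rfl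
  rw [hE] at hco
  nlinarith [mul_le_mul_of_nonneg_left hplat hκ.le, mul_nonneg hκ.le hv₁nn]

/-- **The error term tends to zero** along `R = n + 1`. [folklore] -/
theorem tendsto_err (hL : 0 < L) (K : Esp L hL →L[ℝ] W L) (p : Esp L hL) (M C : ℝ) :
    Tendsto (fun n : ℕ =>
      C * (∫ ξ in {ξ : ℝ | ((n : ℝ) + 1) ^ 2 ≤ ξ ^ 2}, (L ^ 2 + ξ ^ 2) * prim (der p) ξ ^ 2)
      + (‖K‖ * Real.sqrt ((1 / 4 + 2 * M ^ 2) * (∫ y in {ξ : ℝ | ((n : ℝ) + 1) ^ 2 ≤ ξ ^ 2}, (L ^ 2 + y ^ 2) * prim (der p) y ^ 2)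
            + 2 * ∫ y in {ξ : ℝ | ((n : ℝ) + 1) ^ 2 ≤ ξ ^ 2}, (L ^ 2 + y ^ 2) * der p y ^ 2)
          + Real.sqrt (∫ y in {ξ : ℝ | ((n : ℝ) + 1) ^ 2 ≤ ξ ^ 2}, (L ^ 2 + y ^ 2) * ((K p : W L) : ℝ → ℝ) y ^ 2))
        * Real.sqrt (∫ y, (L ^ 2 + y ^ 2) * prim (der p) y ^ 2)) atTop (𝓝 0) := by
  obtain ⟨-, -, h0, h1, -, -⟩ := profile_facts hL p
  have hK := weightedSq_of_W hL (K p)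
  have t0 := tendsto_tail h0
  have t1 := tendsto_tail h1
  have tK := tendsto_tail hK
  have hs1 : Tendsto (fun n : ℕ => Real.sqrt ((1 / 4 + 2 * M ^ 2) * (∫ y in {ξ : ℝ | ((n : ℝ) + 1) ^ 2 ≤ ξ ^ 2}, (L ^ 2 + y ^ 2) * prim (der p) y ^ 2)
      + 2 * ∫ y in {ξ : ℝ | ((n : ℝ) + 1) ^ 2 ≤ ξ ^ 2}, (L ^ 2 + y ^ 2) * der p y ^ 2)) atTop (𝓝 0) := by
    have h := ((t0.const_mul (1 / 4 + 2 * M ^ 2)).add (t1.const_mul 2)).sqrt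
    rw [mul_zero, mul_zero, add_zero, Real.sqrt_zero] at h
    exact h
  have hs2 : Tendsto (fun n : ℕ => Real.sqrt (∫ y in {ξ : ℝ | ((n : ℝ) + 1) ^ 2 ≤ ξ ^ 2}, (L ^ 2 + y ^ 2) * ((K p : W L) : ℝ → ℝ) y ^ 2))
      atTop (𝓝 0) := by
    have h := tK.sqrt
    rw [Real.sqrt_zero] at h
    exact h
  have h := (t0.const_mul C).add ((((hs1.const_mul ‖K‖).add hs2).mul_const (Real.sqrt (∫ y, (L ^ 2 + y ^ 2) * prim (der p) y ^ 2))))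
  simp only [mul_zero, zero_mul, add_zero] at h
  exact h

/-! ### §2 Uniqueness for the perturbed operator (scalar) -/

/-- `prim (der 0) = 0`. [folklore] -/
theorem prim_der_zero (hL : 0 < L) : prim (der (0 : Esp L hL)) = fun _ => 0 := by
  have hae : der (0 : Esp L hL) =ᵐ[volume] fun _ => (0 : ℝ) := by
    rw [der_def]
    have : (((0 : Esp L hL) : WithLp 2 (W L × W L)).snd : W L) = 0 := rfl
    rw [this]
    exact ae_volume_of_ae_μw hL (Lp.coeFn_zero ℝ 2 (μw L))
  rw [prim_congr_ae hae]
  funext x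
  simp [prim_apply]

/-- **Uniqueness with a bounded perturbation.**  If the perturbed form is `κ`-coercive on tests and `p ∈ Esp` satisfies
`linForm(u; φ) + ∫ w (Kp) φ = 0` for every compactly supported test, then `p = 0`. [folklore] -/
theorem eq_zero_of_weakK (hL : 0 < L) (hdm : AEStronglyMeasurable d volume) (hVm : AEStronglyMeasurable V volume)
    (hD₀ : 0 ≤ D₀) (hD₁ : 0 ≤ D₁) (hd : ∀ ξ, |d ξ| ≤ D₀ + D₁ * |ξ|) (hV : ∀ ξ, |V ξ| ≤ V₀)
    (K : Esp L hL →L[ℝ] W L) {κ : ℝ} (hκ : 0 < κ)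
    (hcoerK : ∀ vp : testSpace, κ * ‖jmap hL vp‖ ^ 2 ≤
      linForm L d V vp.1.1 vp.1.2 vp.1.1 vp.1.2 + ∫ y, (L ^ 2 + y ^ 2) * (((K (jmap hL vp) : W L) : ℝ → ℝ) y * vp.1.1 y))
    {p : Esp L hL}
    (hweak : ∀ v v₁ : ℝ → ℝ, IsCompactTest v v₁ →
      linForm L d V (prim (der p)) (der p) v v₁ + ∫ y, (L ^ 2 + y ^ 2) * (((K p : W L) : ℝ → ℝ) y * v y) = 0) : p = 0 := by
  obtain ⟨hu', hodd', hu₁m', h0', h1', -, -⟩ := energyClass_of_mem hL p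
  have hu : ∀ x, prim (der p) x = prim (der p) 0 + ∫ s in (0 : ℝ)..x, der p s := hu'
  have hodd : ∀ y, prim (der p) (-y) = -prim (der p) y := hodd'
  have hu₁m : AEStronglyMeasurable (der p) volume := hu₁m'
  have h0 : Integrable fun y => (L ^ 2 + y ^ 2) * prim (der p) y ^ 2 := h0'
  have h1 : Integrable fun y => (L ^ 2 + y ^ 2) * der p y ^ 2 := h1'
  obtain ⟨huc, hu₁2, hu2, -, -⟩ := basic_of_primitive hL hu hu₁m h0 h1
  obtain ⟨M, hM0, hM⟩ := exists_deriv_cutoff_le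
  obtain ⟨C, hC⟩ : ∃ C : ℝ, C = M ^ 2 + 4 * M / L ^ 2 + M * (D₀ + 2 * D₁) := ⟨_, rfl⟩
  set I : ℝ := ∫ ξ, (L ^ 2 + ξ ^ 2) * prim (der p) ξ ^ 2 with hI
  set T : ℕ → ℝ := fun n => ∫ ξ in {ξ : ℝ | ((n : ℝ) + 1) ^ 2 ≤ ξ ^ 2}, (L ^ 2 + ξ ^ 2) * prim (der p) ξ ^ 2 with hT
  set E : ℕ → ℝ := fun n =>
      C * (∫ ξ in {ξ : ℝ | ((n : ℝ) + 1) ^ 2 ≤ ξ ^ 2}, (L ^ 2 + ξ ^ 2) * prim (der p) ξ ^ 2)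
      + (‖K‖ * Real.sqrt ((1 / 4 + 2 * M ^ 2) * (∫ y in {ξ : ℝ | ((n : ℝ) + 1) ^ 2 ≤ ξ ^ 2}, (L ^ 2 + y ^ 2) * prim (der p) y ^ 2)
            + 2 * ∫ y in {ξ : ℝ | ((n : ℝ) + 1) ^ 2 ≤ ξ ^ 2}, (L ^ 2 + y ^ 2) * der p y ^ 2)
          + Real.sqrt (∫ y in {ξ : ℝ | ((n : ℝ) + 1) ^ 2 ≤ ξ ^ 2}, (L ^ 2 + y ^ 2) * ((K p : W L) : ℝ → ℝ) y ^ 2))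
        * Real.sqrt (∫ y, (L ^ 2 + y ^ 2) * prim (der p) y ^ 2) with hE
  have hstep : ∀ n : ℕ, κ / 4 * I ≤ κ / 4 * T n + E n := by
    intro n
    have hR : (1 : ℝ) ≤ (n : ℝ) + 1 := by
      have : (0 : ℝ) ≤ n := Nat.cast_nonneg n
      linarith
    have hR0 : (0 : ℝ) < (n : ℝ) + 1 := by linarith
    have hmeas : MeasurableSet {ξ : ℝ | ((n : ℝ) + 1) ^ 2 ≤ ξ ^ 2} := measurableSet_le measurable_const (by fun_prop)
    have h := cutoff_ineq_K hL hdm hVm hD₀ hD₁ hd hV K hκ hcoerK p hM0 hR (hM _ hR0)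
    rw [← hC] at h
    have hτ2 := isCompactTest_cutoff_sq_mul hR0 hu hodd hu₁2 hu2
    rw [hweak _ _ hτ2] at h
    have hs : ∫ ξ in {ξ : ℝ | ((n : ℝ) + 1) ^ 2 ≤ ξ ^ 2}ᶜ, (L ^ 2 + ξ ^ 2) * prim (der p) ξ ^ 2 = I - T n := by
      rw [hI, hT, ← integral_add_compl hmeas h0]; ring
    rw [hs] at h
    have : κ / 4 * (I - T n) ≤ E n := by
      simp only [hE]
      linarith
    linarith
  have hlim : Tendsto (fun n : ℕ => κ / 4 * T n + E n) atTop (𝓝 (κ / 4 * 0 + 0)) :=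
    ((tendsto_tail h0).const_mul _).add (tendsto_err hL K p M C)
  rw [mul_zero, add_zero] at hlim
  have hI0 : κ / 4 * I ≤ 0 := ge_of_tendsto' hlim hstep
  have hInn : 0 ≤ I := integral_nonneg fun ξ => by positivity
  have hIz : I = 0 := by nlinarith
  have hz := eq_zero_of_weightedSq_eq_zero hL huc h0 hIz
  exact ext_of_prim_eq hL fun x => by rw [hz x, prim_der_zero hL]

/-! ### §3 Uniqueness for the perturbed skew-coupled pair -/

/-- **Pair uniqueness with a bounded perturbation.**  If the perturbed form is `κ`-coercive on tests and `p_R, p_I ∈ Esp` satisfy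
`linForm(u_R; φ) + ∫w(Kp_R)φ − t∫w u_I φ = 0` and `linForm(u_I; φ) + ∫w(Kp_I)φ + t∫w u_R φ = 0` for all compactly supported tests, then
`p_R = 0` and `p_I = 0`. [folklore] -/
theorem pair_eq_zero_of_weakK (hL : 0 < L) (hdm : AEStronglyMeasurable d volume) (hVm : AEStronglyMeasurable V volume)
    (hD₀ : 0 ≤ D₀) (hD₁ : 0 ≤ D₁) (hd : ∀ ξ, |d ξ| ≤ D₀ + D₁ * |ξ|) (hV : ∀ ξ, |V ξ| ≤ V₀)
    (K : Esp L hL →L[ℝ] W L) {κ : ℝ} (hκ : 0 < κ)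
    (hcoerK : ∀ vp : testSpace, κ * ‖jmap hL vp‖ ^ 2 ≤
      linForm L d V vp.1.1 vp.1.2 vp.1.1 vp.1.2 + ∫ y, (L ^ 2 + y ^ 2) * (((K (jmap hL vp) : W L) : ℝ → ℝ) y * vp.1.1 y))
    (t : ℝ) {pR pI : Esp L hL}
    (hweakR : ∀ v v₁ : ℝ → ℝ, IsCompactTest v v₁ →
      linForm L d V (prim (der pR)) (der pR) v v₁ + (∫ y, (L ^ 2 + y ^ 2) * (((K pR : W L) : ℝ → ℝ) y * v y))
        - t * ∫ y, (L ^ 2 + y ^ 2) * (prim (der pI) y * v y) = 0)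
    (hweakI : ∀ v v₁ : ℝ → ℝ, IsCompactTest v v₁ →
      linForm L d V (prim (der pI)) (der pI) v v₁ + (∫ y, (L ^ 2 + y ^ 2) * (((K pI : W L) : ℝ → ℝ) y * v y))
        + t * ∫ y, (L ^ 2 + y ^ 2) * (prim (der pR) y * v y) = 0) :
    pR = 0 ∧ pI = 0 := by
  obtain ⟨huR', hoddR', huR₁m', h0R', h1R', -, -⟩ := energyClass_of_mem hL pR
  have huR : ∀ x, prim (der pR) x = prim (der pR) 0 + ∫ s in (0 : ℝ)..x, der pR s := huR'
  have hoddR : ∀ y, prim (der pR) (-y) = -prim (der pR) y := hoddR'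
  have huR₁m : AEStronglyMeasurable (der pR) volume := huR₁m'
  have h0R : Integrable fun y => (L ^ 2 + y ^ 2) * prim (der pR) y ^ 2 := h0R'
  have h1R : Integrable fun y => (L ^ 2 + y ^ 2) * der pR y ^ 2 := h1R'
  obtain ⟨huRc, huR₁2, huR2, -, -⟩ := basic_of_primitive hL huR huR₁m h0R h1R
  obtain ⟨huI', hoddI', huI₁m', h0I', h1I', -, -⟩ := energyClass_of_mem hL pI
  have huI : ∀ x, prim (der pI) x = prim (der pI) 0 + ∫ s in (0 : ℝ)..x, der pI s := huI'
  have hoddI : ∀ y, prim (der pI) (-y) = -prim (der pI) y := hoddI'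
  have huI₁m : AEStronglyMeasurable (der pI) volume := huI₁m'
  have h0I : Integrable fun y => (L ^ 2 + y ^ 2) * prim (der pI) y ^ 2 := h0I'
  have h1I : Integrable fun y => (L ^ 2 + y ^ 2) * der pI y ^ 2 := h1I'
  obtain ⟨huIc, huI₁2, huI2, -, -⟩ := basic_of_primitive hL huI huI₁m h0I h1I
  obtain ⟨M, hM0, hM⟩ := exists_deriv_cutoff_le
  obtain ⟨C, hC⟩ : ∃ C : ℝ, C = M ^ 2 + 4 * M / L ^ 2 + M * (D₀ + 2 * D₁) := ⟨_, rfl⟩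
  set IR : ℝ := ∫ ξ, (L ^ 2 + ξ ^ 2) * prim (der pR) ξ ^ 2 with hIR
  set II : ℝ := ∫ ξ, (L ^ 2 + ξ ^ 2) * prim (der pI) ξ ^ 2 with hII
  set TR : ℕ → ℝ := fun n => ∫ ξ in {ξ : ℝ | ((n : ℝ) + 1) ^ 2 ≤ ξ ^ 2}, (L ^ 2 + ξ ^ 2) * prim (der pR) ξ ^ 2 with hTR
  set TI : ℕ → ℝ := fun n => ∫ ξ in {ξ : ℝ | ((n : ℝ) + 1) ^ 2 ≤ ξ ^ 2}, (L ^ 2 + ξ ^ 2) * prim (der pI) ξ ^ 2 with hTI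
  set ER : ℕ → ℝ := fun n =>
      C * (∫ ξ in {ξ : ℝ | ((n : ℝ) + 1) ^ 2 ≤ ξ ^ 2}, (L ^ 2 + ξ ^ 2) * prim (der pR) ξ ^ 2)
      + (‖K‖ * Real.sqrt ((1 / 4 + 2 * M ^ 2) * (∫ y in {ξ : ℝ | ((n : ℝ) + 1) ^ 2 ≤ ξ ^ 2}, (L ^ 2 + y ^ 2) * prim (der pR) y ^ 2)
            + 2 * ∫ y in {ξ : ℝ | ((n : ℝ) + 1) ^ 2 ≤ ξ ^ 2}, (L ^ 2 + y ^ 2) * der pR y ^ 2)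
          + Real.sqrt (∫ y in {ξ : ℝ | ((n : ℝ) + 1) ^ 2 ≤ ξ ^ 2}, (L ^ 2 + y ^ 2) * ((K pR : W L) : ℝ → ℝ) y ^ 2))
        * Real.sqrt (∫ y, (L ^ 2 + y ^ 2) * prim (der pR) y ^ 2) with hER
  set EI : ℕ → ℝ := fun n =>
      C * (∫ ξ in {ξ : ℝ | ((n : ℝ) + 1) ^ 2 ≤ ξ ^ 2}, (L ^ 2 + ξ ^ 2) * prim (der pI) ξ ^ 2)
      + (‖K‖ * Real.sqrt ((1 / 4 + 2 * M ^ 2) * (∫ y in {ξ : ℝ | ((n : ℝ) + 1) ^ 2 ≤ ξ ^ 2}, (L ^ 2 + y ^ 2) * prim (der pI) y ^ 2)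
            + 2 * ∫ y in {ξ : ℝ | ((n : ℝ) + 1) ^ 2 ≤ ξ ^ 2}, (L ^ 2 + y ^ 2) * der pI y ^ 2)
          + Real.sqrt (∫ y in {ξ : ℝ | ((n : ℝ) + 1) ^ 2 ≤ ξ ^ 2}, (L ^ 2 + y ^ 2) * ((K pI : W L) : ℝ → ℝ) y ^ 2))
        * Real.sqrt (∫ y, (L ^ 2 + y ^ 2) * prim (der pI) y ^ 2) with hEI
  have hstep : ∀ n : ℕ, κ / 4 * (IR + II) ≤ κ / 4 * (TR n + TI n) + (ER n + EI n) := by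
    intro n
    have hR : (1 : ℝ) ≤ (n : ℝ) + 1 := by
      have : (0 : ℝ) ≤ n := Nat.cast_nonneg n
      linarith
    have hR0 : (0 : ℝ) < (n : ℝ) + 1 := by linarith
    have hmeas : MeasurableSet {ξ : ℝ | ((n : ℝ) + 1) ^ 2 ≤ ξ ^ 2} := measurableSet_le measurable_const (by fun_prop)
    have hRi := cutoff_ineq_K hL hdm hVm hD₀ hD₁ hd hV K hκ hcoerK pR hM0 hR (hM _ hR0)
    have hIi := cutoff_ineq_K hL hdm hVm hD₀ hD₁ hd hV K hκ hcoerK pI hM0 hR (hM _ hR0)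
    rw [← hC] at hRi hIi
    have hτR2 := isCompactTest_cutoff_sq_mul hR0 huR hoddR huR₁2 huR2
    have hτI2 := isCompactTest_cutoff_sq_mul hR0 huI hoddI huI₁2 huI2
    have eR := sub_eq_zero.mp (hweakR _ _ hτR2)
    have eI := eq_neg_of_add_eq_zero_left (hweakI _ _ hτI2)
    have hcross : ∫ y, (L ^ 2 + y ^ 2) * (prim (der pI) y * (cutoff ((n : ℝ) + 1) y * (cutoff ((n : ℝ) + 1) y * prim (der pR) y))) =
        ∫ y, (L ^ 2 + y ^ 2) * (prim (der pR) y * (cutoff ((n : ℝ) + 1) y * (cutoff ((n : ℝ) + 1) y * prim (der pI) y))) :=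
      integral_congr_ae (Eventually.of_forall fun y => by ring)
    rw [eR, hcross] at hRi
    rw [eI] at hIi
    have hsR : ∫ ξ in {ξ : ℝ | ((n : ℝ) + 1) ^ 2 ≤ ξ ^ 2}ᶜ, (L ^ 2 + ξ ^ 2) * prim (der pR) ξ ^ 2 = IR - TR n := by
      rw [hIR, hTR, ← integral_add_compl hmeas h0R]; ring
    have hsI : ∫ ξ in {ξ : ℝ | ((n : ℝ) + 1) ^ 2 ≤ ξ ^ 2}ᶜ, (L ^ 2 + ξ ^ 2) * prim (der pI) ξ ^ 2 = II - TI n := by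
      rw [hII, hTI, ← integral_add_compl hmeas h0I]; ring
    rw [hsR] at hRi
    rw [hsI] at hIi
    have h1 : κ / 4 * (IR - TR n) + κ / 4 * (II - TI n) ≤ ER n + EI n := by
      simp only [hER, hEI]
      linarith
    linarith
  have hlim : Tendsto (fun n : ℕ => κ / 4 * (TR n + TI n) + (ER n + EI n)) atTop (𝓝 (κ / 4 * (0 + 0) + (0 + 0))) :=
    (((tendsto_tail h0R).add (tendsto_tail h0I)).const_mul _).add ((tendsto_err hL K pR M C).add (tendsto_err hL K pI M C))
  simp only [add_zero, mul_zero] at hlim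
  have hI0 : κ / 4 * (IR + II) ≤ 0 := ge_of_tendsto' hlim hstep
  have hIRnn : 0 ≤ IR := integral_nonneg fun ξ => by positivity
  have hIInn : 0 ≤ II := integral_nonneg fun ξ => by positivity
  have hsum : IR + II ≤ 0 := by
    by_contra hpos
    have := mul_pos (by positivity : 0 < κ / 4) (not_le.1 hpos)
    linarith
  have hIRz : IR = 0 := by linarith
  have hIIz : II = 0 := by linarith
  have hzR := eq_zero_of_weightedSq_eq_zero hL huRc h0R hIRz
  have hzI := eq_zero_of_weightedSq_eq_zero hL huIc h0I hIIz
  exact ⟨ext_of_prim_eq hL fun x => by rw [hzR x, prim_der_zero hL], ext_of_prim_eq hL fun x => by rw [hzI x, prim_der_zero hL]⟩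

end SheetRPerturbedUniqueness
end Summit.NavierStokesRegularity.OSWSelfSimilar

end
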